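import Mathlib
import Summits.ValiantsHypothesis.ValiantsHypothesis.Theorems.NewtonUnitEquationsDissociatedUniformTotalsLawMinkowskiExactCount
import Summits.ValiantsHypothesis.ValiantsHypothesis.Theorems.NewtonUnitEquationsDissociatedUniformTotalsLawFibreSumWitness8
import HarnessLib

/-!
# Crux `NewtonUnitEquations.DissociatedUniform` (stmt-ValiantsHypothesis-5905): **`FibreSumDominance C` is FALSE for EVERY `C`** —
# product configurations double `(T − V_P − V_Q − V_R)/|G|`

The refinement `FibreSumDominance C : T ≤ V_P + V_Q + V_R + C·|G|` of the `n = 3` totals law (typed in `…TotalsLaw`, memo NOTES-t1 §3,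
"census-sharp with `C = 0`") was refuted for `C = 0` at `q = 6` (`…TotalsLawFibreSumWitness`) and for `C = 1` at `q = 8`
(`…TotalsLawFibreSumWitness8`: injective `A8, B8, C8` with `T = 124`, `V_P + V_Q + V_R = 114`).  This file kills it for every `C`:

* `twist t v = v + t·perp v` (the linear map "multiply by `1 + it`": injective, `⟨twist w, twist y⟩ = (1+t²)⟨w, y⟩`, so strict tops and
  vertex counts are preserved: `ncard_extremePoints_image_twist`); `prodCurve t a₁ a₂ (x₁, x₂) = a₁ x₁ + twist t (a₂ x₂)` on `G₁ × G₂`;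
* `classPts_prod` / `fibrePts_prod`: every class (fibre) of the product is the MINKOWSKI SUM of a class (fibre) of the first factor and
  the twisted class (fibre) of the second;
* `cross_twist` (`cross d₁ (twist t d₂) = cross d₁ d₂ + t⟨d₁,d₂⟩`: each pair of chords forbids at most one `t`, `cross_twist_ne_zero`),
  so for `t` outside the finite set of bad values no chord of a class of factor 1 is parallel to a chord of the twisted class of
  factor 2, and `…MinkowskiExactCount.add_le_ncard_extremePoints_add` gives `V ≥ V₁ + V₂` class by class, while the tree's
  `ncard_extremePoints_add_le` gives `V ≤ V₁ + V₂` fibre by fibre: **`exists_prod_config`**: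
  `T ≥ |G₂|T₁ + |G₁|T₂`, `V_X ≤ |G₂|V_X₁ + |G₁|V_X₂` (`X = P, Q, R`), i.e. `(T − S)/|G|` ADDS UP over products;
* **`exists_fibreSum_gap`**: squaring the `ℤ/8` witness `j` times gives a configuration over `(ℤ/8)^(2^j)` with
  `4(T − S) ≥ 5·2^j·|G|`; **`not_fibreSumDominance : ∀ C, ¬ FibreSumDominance C`**.
So no refinement of the form `T ≤ V_P + V_Q + V_R + C|G|` holds over all finite abelian groups: the three fibre systems are the wrong
currency for an `O(|G|)` correction (whether `+ o(|G|²)` survives, or what happens for cyclic groups of prime order, is open — census of the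
seat memo: no violation found at `q = 4, 5, 7`).  The totals law `TotalsLawThree C` itself is untouched and OPEN (products are ADDITIVE
for `T/|G|`: `T/|G|²` only decreases); nothing here bears on VP ≠ VNP.
[folklore: vertices of Minkowski sums; a linear similarity preserves extreme points]
-/

set_option linter.dupNamespace false -- `ValiantsHypothesis.ValiantsHypothesis` (summit = problem) in every name

open scoped BigOperators Pointwise

namespace Summit.ValiantsHypothesis.ValiantsHypothesis.Theorems.NewtonUnitEquationsDissociatedUniform

namespace TotalsLaw

section FibreSumProduct

open Literature.Computability.AlgebraicComplexity.KPTT.PlanarMinkowski MinkowskiExact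

/-! ### The twist `v ↦ v + t·perp v` (rotation–scaling by `(1, t)`) -/

/-- Rotation–scaling by the complex number `1 + i t`. -/
def twist (t : ℝ) (v : Fin 2 → ℝ) : Fin 2 → ℝ := v + t • perp v

/-- `twist` is additive. [folklore] -/
theorem twist_add (t : ℝ) (u v : Fin 2 → ℝ) : twist t (u + v) = twist t u + twist t v := by
  unfold twist; rw [perp_add, smul_add]; abel

/-- `twist` on differences. [folklore] -/
theorem twist_sub (t : ℝ) (u v : Fin 2 → ℝ) : twist t (u - v) = twist t u - twist t v := by
  have h := twist_add t (u - v) v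
  rw [sub_add_cancel] at h
  rw [h, add_sub_cancel_right]

/-- The twist multiplies pairings of twisted vectors by `1 + t²`. [folklore] -/
theorem twist_dot_twist (t : ℝ) (w y : Fin 2 → ℝ) : twist t w ⬝ᵥ twist t y = (1 + t ^ 2) * (w ⬝ᵥ y) := by
  simp only [twist, dot_two, Pi.add_apply, Pi.smul_apply, smul_eq_mul, perp_zero, perp_one]; ring

/-- Untwisting: `twist t (twist (−t) w) = (1 + t²) w`. [folklore] -/
theorem twist_twist_neg (t : ℝ) (w : Fin 2 → ℝ) : twist t (twist (-t) w) = (1 + t ^ 2) • w := by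
  unfold twist
  rw [perp_add, perp_smul, perp_perp]
  module

/-- `twist` is injective. [folklore] -/
theorem twist_injective (t : ℝ) : Function.Injective (twist t) := by
  intro u v h
  have key : ∀ w : Fin 2 → ℝ, (1 + t ^ 2) * (w ⬝ᵥ u) = (1 + t ^ 2) * (w ⬝ᵥ v) := fun w => by
    rw [← twist_dot_twist, ← twist_dot_twist, h]
  have ht : (1 + t ^ 2) ≠ 0 := by positivity
  ext i; fin_cases i
  · have := key ![1, 0]
    simp only [dot_two, Fin.isValue, Matrix.cons_val_zero, Matrix.cons_val_one, one_mul, zero_mul, add_zero] at this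
    exact mul_left_cancel₀ ht this
  · have := key ![0, 1]
    simp only [dot_two, Fin.isValue, Matrix.cons_val_zero, Matrix.cons_val_one, one_mul, zero_mul, zero_add] at this
    exact mul_left_cancel₀ ht this

/-- The chord obstruction is linear in `t`: `cross d₁ (twist t d₂) = cross d₁ d₂ + t ⟨d₁, d₂⟩`. [folklore] -/
theorem cross_twist (t : ℝ) (d₁ d₂ : Fin 2 → ℝ) : cross d₁ (twist t d₂) = cross d₁ d₂ + t * (d₁ ⬝ᵥ d₂) := by
  simp only [cross, twist, dot_two, Pi.add_apply, Pi.smul_apply, smul_eq_mul, perp_zero, perp_one]; ring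

/-- Lagrange's identity `⟨d₁,d₂⟩² + cross(d₁,d₂)² = |d₁|²|d₂|²`. [folklore] -/
theorem lagrange (d₁ d₂ : Fin 2 → ℝ) :
    (d₁ ⬝ᵥ d₂) ^ 2 + cross d₁ d₂ ^ 2 = (d₁ 0 ^ 2 + d₁ 1 ^ 2) * (d₂ 0 ^ 2 + d₂ 1 ^ 2) := by
  simp only [dot_two, cross]; ring

/-- Strict tops transport under the twist. [folklore] -/
theorem isStrictTop_twist {t : ℝ} {F : Finset (Fin 2 → ℝ)} {w x : Fin 2 → ℝ} (h : IsStrictTop w F x) :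
    IsStrictTop (twist t w) (F.image (twist t)) (twist t x) := by
  classical
  refine ⟨Finset.mem_image.2 ⟨x, h.1, rfl⟩, fun y hy hne => ?_⟩
  obtain ⟨y₀, hy₀, rfl⟩ := Finset.mem_image.1 hy
  have hne₀ : y₀ ≠ x := fun h0 => hne (by rw [h0])
  rw [twist_dot_twist, twist_dot_twist]
  exact mul_lt_mul_of_pos_left (h.2 y₀ hy₀ hne₀) (by positivity)

/-- **The twist preserves vertex counts** (it is an invertible linear map). [folklore] -/
theorem ncard_extremePoints_image_twist (t : ℝ) (F : Finset (Fin 2 → ℝ)) :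
    ((convexHull ℝ ((F.image (twist t) : Finset (Fin 2 → ℝ)) : Set (Fin 2 → ℝ))).extremePoints ℝ).ncard =
      ((convexHull ℝ (F : Set (Fin 2 → ℝ))).extremePoints ℝ).ncard := by
  classical
  have heq : (convexHull ℝ ((F.image (twist t) : Finset (Fin 2 → ℝ)) : Set (Fin 2 → ℝ))).extremePoints ℝ =
      twist t '' (convexHull ℝ (F : Set (Fin 2 → ℝ))).extremePoints ℝ := by
    ext z
    constructor
    · intro hz
      obtain ⟨w', hw'⟩ := exists_isStrictTop_of_mem_extremePoints hz
      obtain ⟨x, hx, rfl⟩ := Finset.mem_image.1 hw'.1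
      refine ⟨x, ?_, rfl⟩
      -- untwist the weight
      have h1 : IsStrictTop ((1 + t ^ 2) • w') (F.image (twist t)) (twist t x) := hw'.smul_pos (by positivity)
      rw [← twist_twist_neg] at h1
      refine IsStrictTop.mem_extremePoints (w := twist (-t) w') ⟨hx, fun y hy hne => ?_⟩
      have := h1.2 (twist t y) (Finset.mem_image.2 ⟨y, hy, rfl⟩) (fun h0 => hne (twist_injective t h0))
      rw [twist_dot_twist, twist_dot_twist] at this
      exact lt_of_mul_lt_mul_left this (by positivity)
    · rintro ⟨x, hx, rfl⟩
      obtain ⟨w, hw⟩ := exists_isStrictTop_of_mem_extremePoints hx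
      exact (isStrictTop_twist hw).mem_extremePoints
  rw [heq, Set.ncard_image_of_injective _ (twist_injective t)]

/-! ### Product curves over `G₁ × G₂` -/

variable {G₁ G₂ : Type*} [AddCommGroup G₁] [Fintype G₁] [AddCommGroup G₂] [Fintype G₂]

/-- The product curve `x ↦ a₁ x.1 + twist t (a₂ x.2)`. -/
def prodCurve (t : ℝ) (a₁ : G₁ → (Fin 2 → ℝ)) (a₂ : G₂ → (Fin 2 → ℝ)) : G₁ × G₂ → (Fin 2 → ℝ) :=
  fun x => a₁ x.1 + twist t (a₂ x.2)

omit [Fintype G₁] [Fintype G₂] in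
/-- **Classes of the product are Minkowski sums of classes.** [folklore] -/
theorem classPts_prod (t : ℝ) (a₁ b₁ c₁ : G₁ → (Fin 2 → ℝ)) (a₂ b₂ c₂ : G₂ → (Fin 2 → ℝ)) (s : G₁ × G₂) :
    classPts (prodCurve t a₁ a₂) (prodCurve t b₁ b₂) (prodCurve t c₁ c₂) s =
      classPts a₁ b₁ c₁ s.1 + twist t '' classPts a₂ b₂ c₂ s.2 := by
  ext p
  simp only [classPts, prodCurve, Set.mem_add, Set.mem_range, Set.mem_image, Prod.exists, Prod.fst_sub, Prod.snd_sub]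
  constructor
  · rintro ⟨x₁, x₂, y₁, y₂, rfl⟩
    refine ⟨_, ⟨x₁, y₁, rfl⟩, _, ⟨_, ⟨x₂, y₂, rfl⟩, rfl⟩, ?_⟩
    rw [twist_add, twist_add]; abel
  · rintro ⟨_, ⟨x₁, y₁, rfl⟩, _, ⟨_, ⟨x₂, y₂, rfl⟩, rfl⟩, rfl⟩
    refine ⟨x₁, x₂, y₁, y₂, ?_⟩
    rw [twist_add, twist_add]; abel

omit [Fintype G₁] [Fintype G₂] in
/-- **Fibres of the product are Minkowski sums of fibres.** [folklore] -/
theorem fibrePts_prod (t : ℝ) (a₁ b₁ : G₁ → (Fin 2 → ℝ)) (a₂ b₂ : G₂ → (Fin 2 → ℝ)) (r : G₁ × G₂) :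
    fibrePts (prodCurve t a₁ a₂) (prodCurve t b₁ b₂) r = fibrePts a₁ b₁ r.1 + twist t '' fibrePts a₂ b₂ r.2 := by
  ext p
  simp only [fibrePts, prodCurve, Set.mem_add, Set.mem_range, Set.mem_image, Prod.exists, Prod.fst_sub, Prod.snd_sub]
  constructor
  · rintro ⟨x₁, x₂, rfl⟩
    refine ⟨_, ⟨x₁, rfl⟩, _, ⟨_, ⟨x₂, rfl⟩, rfl⟩, ?_⟩
    rw [twist_add]; abel
  · rintro ⟨_, ⟨x₁, rfl⟩, _, ⟨_, ⟨x₂, rfl⟩, rfl⟩, rfl⟩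
    exact ⟨x₁, x₂, by rw [twist_add]; abel⟩

/-- Finset model of a class of a general finite abelian group. -/
noncomputable def clFin {G : Type*} [AddCommGroup G] [Fintype G] (a b c : G → (Fin 2 → ℝ)) (s : G) : Finset (Fin 2 → ℝ) :=
  Finset.univ.image fun xy : G × G => a xy.1 + b xy.2 + c (s - xy.1 - xy.2)

/-- Finset model of a fibre. -/
noncomputable def fbFin {G : Type*} [AddCommGroup G] [Fintype G] (a b : G → (Fin 2 → ℝ)) (r : G) : Finset (Fin 2 → ℝ) :=
  Finset.univ.image fun x : G => a x + b (r - x)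

/-- The carrier of the Finset model of a class. [folklore] -/
theorem coe_clFin {G : Type*} [AddCommGroup G] [Fintype G] (a b c : G → (Fin 2 → ℝ)) (s : G) :
    (clFin a b c s : Set (Fin 2 → ℝ)) = classPts a b c s := by
  unfold clFin classPts; rw [Finset.coe_image, Finset.coe_univ, Set.image_univ]

/-- The carrier of the Finset model of a fibre. [folklore] -/
theorem coe_fbFin {G : Type*} [AddCommGroup G] [Fintype G] (a b : G → (Fin 2 → ℝ)) (r : G) :
    (fbFin a b r : Set (Fin 2 → ℝ)) = fibrePts a b r := by
  unfold fbFin fibrePts; rw [Finset.coe_image, Finset.coe_univ, Set.image_univ]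

/-- A class with at least two hull vertices has two distinct points. [folklore] -/
theorem exists_pair_of_two_le_classVert {G : Type*} [AddCommGroup G] [Fintype G] {a b c : G → (Fin 2 → ℝ)} {s : G}
    (h : 2 ≤ classVert a b c s) : ∃ p ∈ clFin a b c s, ∃ q ∈ clFin a b c s, p ≠ q := by
  classical
  unfold classVert at h
  have hfin : ((convexHull ℝ (classPts a b c s)).extremePoints ℝ).Finite :=
    (Set.finite_range _).subset extremePoints_convexHull_subset
  have h1 : 1 < ((convexHull ℝ (classPts a b c s)).extremePoints ℝ).ncard := h
  obtain ⟨p, hp, q, hq, hpq⟩ := (Set.one_lt_ncard hfin).1 h1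
  refine ⟨p, ?_, q, ?_, hpq⟩
  · rw [← Finset.mem_coe, coe_clFin]; exact extremePoints_convexHull_subset hp
  · rw [← Finset.mem_coe, coe_clFin]; exact extremePoints_convexHull_subset hq

/-- The bad twists for a pair of chords. -/
noncomputable def badT (d₁ d₂ : Fin 2 → ℝ) : ℝ := -cross d₁ d₂ / (d₁ ⬝ᵥ d₂)

/-- Off the bad value, twisted chords are never parallel. [folklore] -/
theorem cross_twist_ne_zero {t : ℝ} {d₁ d₂ : Fin 2 → ℝ} (h₁ : d₁ ≠ 0) (h₂ : d₂ ≠ 0) (ht : t ≠ badT d₁ d₂) :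
    cross d₁ (twist t d₂) ≠ 0 := by
  rw [cross_twist]
  intro h0
  by_cases hd : d₁ ⬝ᵥ d₂ = 0
  · rw [hd, mul_zero, add_zero] at h0
    have hl := lagrange d₁ d₂
    rw [hd, h0] at hl
    have := mul_pos (normSq_pos h₁) (normSq_pos h₂)
    nlinarith
  · apply ht
    rw [badT, eq_div_iff hd]
    linarith

/-- **The product step.**  Given configurations on `G₁` and `G₂` all of whose classes have at least two hull vertices, the product
configuration for a generic twist has every class a Minkowski sum with exactly `V₁ + V₂` vertices and every fibre a Minkowski sum
with at most `V₁ + V₂` vertices: `T ≥ |G₂|·T₁ + |G₁|·T₂`, `V_P ≤ |G₂|·V_P₁ + |G₁|·V_P₂` (and `Q`, `R`). [folklore] -/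
theorem exists_prod_config (a₁ b₁ c₁ : G₁ → (Fin 2 → ℝ)) (a₂ b₂ c₂ : G₂ → (Fin 2 → ℝ))
    (h₁ : ∀ s, 2 ≤ classVert a₁ b₁ c₁ s) (h₂ : ∀ s, 2 ≤ classVert a₂ b₂ c₂ s) :
    ∃ a b c : G₁ × G₂ → (Fin 2 → ℝ), (∀ s, 2 ≤ classVert a b c s) ∧
      Fintype.card G₂ * totalVert a₁ b₁ c₁ + Fintype.card G₁ * totalVert a₂ b₂ c₂ ≤ totalVert a b c ∧
      fibreTotal a b ≤ Fintype.card G₂ * fibreTotal a₁ b₁ + Fintype.card G₁ * fibreTotal a₂ b₂ ∧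
      fibreTotal b c ≤ Fintype.card G₂ * fibreTotal b₁ c₁ + Fintype.card G₁ * fibreTotal b₂ c₂ ∧
      fibreTotal c a ≤ Fintype.card G₂ * fibreTotal c₁ a₁ + Fintype.card G₁ * fibreTotal c₂ a₂ := by
  classical
  -- the finitely many bad twists
  set B : Finset ℝ := (Finset.univ : Finset (G₁ × G₂)).biUnion fun s =>
      ((clFin a₁ b₁ c₁ s.1 ×ˢ clFin a₁ b₁ c₁ s.1) ×ˢ (clFin a₂ b₂ c₂ s.2 ×ˢ clFin a₂ b₂ c₂ s.2)).image
        fun pq => badT (pq.1.1 - pq.1.2) (pq.2.1 - pq.2.2) with hB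
  obtain ⟨t, ht⟩ := Infinite.exists_notMem_finset B
  refine ⟨prodCurve t a₁ a₂, prodCurve t b₁ b₂, prodCurve t c₁ c₂, ?_⟩
  -- classes: exact count
  have hclass : ∀ s : G₁ × G₂, classVert a₁ b₁ c₁ s.1 + classVert a₂ b₂ c₂ s.2 ≤
      classVert (prodCurve t a₁ a₂) (prodCurve t b₁ b₂) (prodCurve t c₁ c₂) s := by
    intro s
    have hX := exists_pair_of_two_le_classVert (h₁ s.1)
    obtain ⟨u₀, hu₀, v₀, hv₀, huv₀⟩ := exists_pair_of_two_le_classVert (h₂ s.2)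
    have hY : ∃ u ∈ (clFin a₂ b₂ c₂ s.2).image (twist t), ∃ v ∈ (clFin a₂ b₂ c₂ s.2).image (twist t), u ≠ v :=
      ⟨twist t u₀, Finset.mem_image_of_mem _ hu₀, twist t v₀, Finset.mem_image_of_mem _ hv₀,
        fun h => huv₀ (twist_injective t h)⟩
    have hGP : ∀ p ∈ clFin a₁ b₁ c₁ s.1, ∀ q ∈ clFin a₁ b₁ c₁ s.1, ∀ u ∈ (clFin a₂ b₂ c₂ s.2).image (twist t),
        ∀ v ∈ (clFin a₂ b₂ c₂ s.2).image (twist t), p ≠ q → u ≠ v → cross (p - q) (u - v) ≠ 0 := by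
      intro p hp q hq u hu v hv hpq huv
      obtain ⟨u₁, hu₁, rfl⟩ := Finset.mem_image.1 hu
      obtain ⟨v₁, hv₁, rfl⟩ := Finset.mem_image.1 hv
      rw [← twist_sub]
      refine cross_twist_ne_zero (sub_ne_zero.2 hpq) (sub_ne_zero.2 fun h => huv (by rw [h])) fun hbad => ht ?_
      rw [hB, Finset.mem_biUnion]
      refine ⟨s, Finset.mem_univ _, Finset.mem_image.2 ⟨((p, q), (u₁, v₁)), ?_, hbad.symm⟩⟩
      simp only [Finset.mem_product]
      exact ⟨⟨hp, hq⟩, hu₁, hv₁⟩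
    have key := add_le_ncard_extremePoints_add (clFin a₁ b₁ c₁ s.1) ((clFin a₂ b₂ c₂ s.2).image (twist t)) hX hY hGP
    rw [ncard_extremePoints_image_twist] at key
    unfold classVert
    rw [classPts_prod, ← coe_clFin, ← coe_clFin, ← Finset.coe_image, ← Finset.coe_add]
    exact key
  -- fibres: upper bound
  have hfibre : ∀ (x₁ y₁ : G₁ → (Fin 2 → ℝ)) (x₂ y₂ : G₂ → (Fin 2 → ℝ)) (r : G₁ × G₂),
      fibreVert (prodCurve t x₁ x₂) (prodCurve t y₁ y₂) r ≤ fibreVert x₁ y₁ r.1 + fibreVert x₂ y₂ r.2 := by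
    intro x₁ y₁ x₂ y₂ r
    have hne₁ : (fbFin x₁ y₁ r.1).Nonempty := ⟨_, Finset.mem_image.2 ⟨0, Finset.mem_univ _, rfl⟩⟩
    have hne₂ : ((fbFin x₂ y₂ r.2).image (twist t)).Nonempty :=
      ⟨_, Finset.mem_image.2 ⟨_, Finset.mem_image.2 ⟨0, Finset.mem_univ _, rfl⟩, rfl⟩⟩
    have key := ncard_extremePoints_add_le hne₁ hne₂
    rw [ncard_extremePoints_image_twist] at key
    unfold fibreVert
    rw [fibrePts_prod, ← coe_fbFin, ← coe_fbFin, ← Finset.coe_image, ← Finset.coe_add]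
    exact key
  have hsumT : ∑ s : G₁ × G₂, (classVert a₁ b₁ c₁ s.1 + classVert a₂ b₂ c₂ s.2) =
      Fintype.card G₂ * totalVert a₁ b₁ c₁ + Fintype.card G₁ * totalVert a₂ b₂ c₂ := by
    rw [Finset.sum_add_distrib, Fintype.sum_prod_type, Fintype.sum_prod_type]
    simp only [Finset.sum_const, Finset.card_univ, smul_eq_mul]
    unfold totalVert
    rw [Finset.mul_sum, Finset.mul_sum]
  have hsumF : ∀ (x₁ y₁ : G₁ → (Fin 2 → ℝ)) (x₂ y₂ : G₂ → (Fin 2 → ℝ)),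
      fibreTotal (prodCurve t x₁ x₂) (prodCurve t y₁ y₂) ≤ Fintype.card G₂ * fibreTotal x₁ y₁ + Fintype.card G₁ * fibreTotal x₂ y₂ := by
    intro x₁ y₁ x₂ y₂
    unfold fibreTotal
    calc ∑ r : G₁ × G₂, fibreVert (prodCurve t x₁ x₂) (prodCurve t y₁ y₂) r
        ≤ ∑ r : G₁ × G₂, (fibreVert x₁ y₁ r.1 + fibreVert x₂ y₂ r.2) := Finset.sum_le_sum fun r _ => hfibre x₁ y₁ x₂ y₂ r
      _ = Fintype.card G₂ * ∑ r, fibreVert x₁ y₁ r + Fintype.card G₁ * ∑ r, fibreVert x₂ y₂ r := by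
          rw [Finset.sum_add_distrib, Fintype.sum_prod_type, Fintype.sum_prod_type]
          simp only [Finset.sum_const, Finset.card_univ, smul_eq_mul]
          rw [Finset.mul_sum, Finset.mul_sum]
  refine ⟨fun s => le_trans ?_ (hclass s), ?_, hsumF a₁ b₁ a₂ b₂, hsumF b₁ c₁ b₂ c₂, hsumF c₁ a₁ c₂ a₂⟩
  · have := h₁ s.1; have := h₂ s.2; omega
  · rw [← hsumT]
    unfold totalVert
    exact Finset.sum_le_sum fun s _ => hclass s

/-! ### Iteration: no constant survives -/

/-- Every class of the `ℤ/8` witness has at least two hull vertices. [folklore] -/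
theorem two_le_classVert_fsw8 (s : ZMod 8) : 2 ≤ classVert (intCurve A8) (intCurve B8) (intCurve C8) s := by
  have h := length_le_classVert₃ A8 B8 C8 s (row recs8 s) (recs8_ok s).1 (recs8_ok s).2
  have h2 : ∀ s : ZMod 8, 2 ≤ (row recs8 s).length := by decide
  exact le_trans (h2 s) h

/-- **Gap amplification.**  For every `j` there is a configuration over a finite abelian group with
`4·(V_P + V_Q + V_R) + 5·2^j·|G| ≤ 4·T` (the `ℤ/8` witness has `4·114 + 40 = 4·124`; the product of a configuration with itself doubles
`(T − S)/|G|`). [folklore] -/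
theorem exists_fibreSum_gap (j : ℕ) : ∃ (G : Type) (_ : AddCommGroup G) (_ : Fintype G) (a b c : G → (Fin 2 → ℝ)),
    (∀ s, 2 ≤ classVert a b c s) ∧
      4 * (fibreTotal a b + fibreTotal b c + fibreTotal c a) + 5 * 2 ^ j * Fintype.card G ≤ 4 * totalVert a b c := by
  induction j with
  | zero =>
    refine ⟨ZMod 8, inferInstance, inferInstance, intCurve A8, intCurve B8, intCurve C8, two_le_classVert_fsw8, ?_⟩
    have h1 := le_totalVert_fsw8
    have h2 := fibreTotal_P8_le
    have h3 := fibreTotal_Q8_le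
    have h4 := fibreTotal_R8_le
    simp only [ZMod.card, pow_zero, mul_one]
    omega
  | succ j ih =>
    obtain ⟨G, iG, fG, a, b, c, h2, hgap⟩ := ih
    obtain ⟨a', b', c', h2', hT, hP, hQ, hR⟩ := exists_prod_config a b c a b c h2 h2
    refine ⟨G × G, inferInstance, inferInstance, a', b', c', h2', ?_⟩
    rw [Fintype.card_prod, pow_succ]
    have key := Nat.mul_le_mul_left (2 * Fintype.card G) hgap
    nlinarith [key, hT, hP, hQ, hR, Nat.zero_le (Fintype.card G)]

/-- **`FibreSumDominance C` is false for every `C`.** -/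
theorem not_fibreSumDominance (C : ℕ) : ¬ FibreSumDominance C := by
  intro h
  obtain ⟨G, iG, fG, a, b, c, -, hgap⟩ := exists_fibreSum_gap C
  have hle := h G a b c
  have hq : 1 ≤ Fintype.card G := Fintype.card_pos
  have hC : 4 * C < 5 * 2 ^ C := by
    have : C < 2 ^ C := Nat.lt_two_pow_self
    omega
  have : 4 * C * Fintype.card G < 5 * 2 ^ C * Fintype.card G := Nat.mul_lt_mul_of_pos_right hC hq
  nlinarith

end FibreSumProduct

end TotalsLaw

end Summit.ValiantsHypothesis.ValiantsHypothesis.Theorems.NewtonUnitEquationsDissociatedUniform
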